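import Mathlib.Analysis.InnerProductSpace.PiL2
import Summits.Ventures.PackingBounds.Configurations.LeechCount
import Summits.Ventures.PackingBounds.Kissing.DimensionTwentyFour

/-!
# The Leech kissing configuration: `κ(24) = 196560` in Lean (explicit construction + sharp LP bound)

Framing: lottery ticket; floor = certified bounds/negative ranges. Venture `PackingBounds` (cell
`pub-packcert`, seat `pub-packcert-energy`).

The `196560` integer vectors `leechInt` of `Configurations/LeechCount.lean` (the minimal vectors of
`√8 · Λ₂₄`, built from the extended Golay code) scaled by `1/√32` form a set `leech` of `196560` unit
vectors of `ℝ²⁴` with pairwise inner products `≤ 1/2`, i.e. a kissing configuration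
(`exists_kissing_196560`). With the cell's kernel-checked sharp Delsarte LP certificate
`Kissing.kissing_dim24_le_196560` this gives **the kissing number in dimension `24`**,
`kissing_dim24_isGreatest : IsGreatest {N | …} 196560`, as a single theorem whose two sides are both
proved in the tree (no `196560²` enumeration anywhere: the Golay code facts are checked by the kernel on
`4096` codewords, the rest is proved).

## References
* J. Leech, Canad. J. Math. 19 (1967) 251–267; J. H. Conway, N. J. A. Sloane, *Sphere Packings, Lattices
  and Groups*, Ch. 4 §11, Ch. 1 Table 1.2. [`ConwaySloane1999`]
* A. M. Odlyzko, N. J. A. Sloane, J. Combin. Theory Ser. A 26 (1979) 210–214. [`OdlyzkoSloane1979`]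
* V. I. Levenshtein, Soviet Math. Dokl. 20 (1979) 417–421. [`Levenshtein1979`]
-/

namespace Summit.Ventures.PackingBounds.Config.Leech

open Finset WithLp Golay

/-- The vector of `ℝ²⁴` attached to an integer vector, scaled by `1/√q`: `x / √q`. -/
noncomputable def toE (q : ℝ) (x : Fin 24 → ℤ) : EuclideanSpace ℝ (Fin 24) :=
  toLp 2 fun j => (Real.sqrt q)⁻¹ * (x j : ℝ)

/-- `⟪toE q x, toE q y⟫ = ip x y / q` (`q > 0`). -/
theorem inner_toE {q : ℝ} (hq : 0 < q) (x y : Fin 24 → ℤ) :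
    inner ℝ (toE q x) (toE q y) = (ip x y : ℝ) / q := by
  rw [toE, toE, EuclideanSpace.inner_toLp_toLp, dotProduct]
  have hs : (Real.sqrt q)⁻¹ * (Real.sqrt q)⁻¹ = 1 / q := by
    rw [← mul_inv, Real.mul_self_sqrt hq.le, one_div]
  simp only [star_trivial, ip, Int.cast_sum, Int.cast_mul]
  rw [Finset.sum_div]
  refine Finset.sum_congr rfl fun j _ => ?_
  calc (Real.sqrt q)⁻¹ * (y j : ℝ) * ((Real.sqrt q)⁻¹ * (x j : ℝ))
      = ((Real.sqrt q)⁻¹ * (Real.sqrt q)⁻¹) * ((x j : ℝ) * (y j : ℝ)) := by ring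
    _ = (x j : ℝ) * (y j : ℝ) / q := by rw [hs]; ring

/-- `toE q x` is a unit vector when `ip x x = q > 0`. -/
theorem norm_toE {q : ℝ} (hq : 0 < q) {x : Fin 24 → ℤ} (h : (ip x x : ℝ) = q) : ‖toE q x‖ = 1 := by
  have hi := inner_toE hq x x
  rw [h, div_self hq.ne', real_inner_self_eq_norm_sq] at hi
  nlinarith [norm_nonneg (toE q x)]

/-- `toE q` is injective (`q > 0`). -/
theorem toE_injective {q : ℝ} (hq : 0 < q) : Function.Injective (toE q) := by
  intro x y h
  funext j
  have hj := congrArg (fun v : EuclideanSpace ℝ (Fin 24) => v j) h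
  have hs : (Real.sqrt q)⁻¹ ≠ 0 := inv_ne_zero (Real.sqrt_ne_zero'.mpr hq)
  simp only [toE, PiLp.toLp_apply] at hj
  exact_mod_cast mul_left_cancel₀ hs hj

/-- **The Leech kissing configuration**: the `196560` minimal vectors of the Leech lattice, normalised.
[cite: ConwaySloane1999, Ch. 4 §11] -/
noncomputable def leech : Finset (EuclideanSpace ℝ (Fin 24)) := leechInt.image (toE 32)

/-- `|leech| = 196560`. -/
theorem card_leech : leech.card = 196560 := by
  rw [leech, card_image_of_injective _ (toE_injective (by norm_num)), card_leechInt]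

/-- The Leech kissing vectors are unit vectors. -/
theorem norm_leech : ∀ x ∈ leech, ‖x‖ = 1 := by
  intro x hx
  obtain ⟨v, hv, rfl⟩ := mem_image.mp hx
  exact norm_toE (by norm_num) (by rw [ip_self_of_mem hv]; norm_num)

/-- Distinct Leech kissing vectors have inner product `≤ 1/2`. -/
theorem inner_leech : ∀ x ∈ leech, ∀ y ∈ leech, x ≠ y → inner ℝ x y ≤ 1 / 2 := by
  intro x hx y hy hxy
  obtain ⟨v, hv, rfl⟩ := mem_image.mp hx
  obtain ⟨w, hw, rfl⟩ := mem_image.mp hy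
  have hvw : v ≠ w := fun h => hxy (by rw [h])
  rw [inner_toE (by norm_num)]
  have h16 : (ip v w : ℝ) ≤ 16 := by exact_mod_cast ip_le_of_mem hv hw hvw
  rw [div_le_iff₀ (by norm_num)]
  linarith

/-- **`κ(24) ≥ 196560`, attained side**: there is a configuration of `196560` unit vectors of `ℝ²⁴` with
pairwise inner products `≤ 1/2` (the Leech lattice minimal vectors). [cite: ConwaySloane1999, Ch. 4 §11] -/
theorem exists_kissing_196560 : ∃ C : Finset (EuclideanSpace ℝ (Fin 24)),
    C.card = 196560 ∧ (∀ x ∈ C, ‖x‖ = 1) ∧ (∀ x ∈ C, ∀ y ∈ C, x ≠ y → inner ℝ x y ≤ 1 / 2) :=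
  ⟨leech, card_leech, norm_leech, inner_leech⟩

/-- **The kissing number in dimension `24` is `196560`**: `196560` is the greatest cardinality of a set of
unit vectors of `ℝ²⁴` with pairwise inner products `≤ 1/2` (upper bound: the cell's kernel-checked sharp
Delsarte LP certificate `Kissing.kissing_dim24_le_196560`, Odlyzko–Sloane / Levenshtein 1979; attained by
the Leech lattice minimal vectors, this file). [cite: ConwaySloane1999, Ch. 1 Table 1.2] -/
theorem kissing_dim24_isGreatest : IsGreatest {N : ℕ | ∃ C : Finset (EuclideanSpace ℝ (Fin 24)),
    C.card = N ∧ (∀ x ∈ C, ‖x‖ = 1) ∧ (∀ x ∈ C, ∀ y ∈ C, x ≠ y → inner ℝ x y ≤ 1 / 2)} 196560 := by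
  refine ⟨exists_kissing_196560, ?_⟩
  rintro N ⟨C, rfl, h1, h2⟩
  exact Kissing.kissing_dim24_le_196560 C h1 h2

end Summit.Ventures.PackingBounds.Config.Leech
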